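/-
Copyright (c) 2026 the pub-hodgecm-mathlib formalisation cell (harness21).  Prover seat hodgecm-mathlib-LH5-p02 (g4) (ED. 1 §1–§3, ED. 2 §4): line LH3 (closer stub `stub_N9`), LETTER L1 clause (I₁),
LH3-plan (g4) RULING #18 «(H-core) of (B-desc′) NON-GENERIC FACE POINTS» — the part OFF THE REAL WALLS (compact-wall coincidences at the other compact places allowed).
-/
import Literature.NumberTheory.Rogawski1990.ArchOrbFamGExtBoxDescent            -- ★ p851016 (LH3-p04 (g4)): (B-desc) at SEMIREGULAR points — the TEMPLATE of §2; brings ★ (M-UNFOLD) explicit p850499, ★ `exists_std_package`, ★ block descent, ★ D4b, ★ (aM∕eM-SMOOTH), ★ cut-offs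
import Literature.NumberTheory.Automorphic.ArchInnerFormChartOrbitalSmoothWalls   -- ★ p850547 (F0P3a-p07∕p05): `uniformlyProper_gprimeBlock_of_inRegG_place` (per place, modulo `Z(gprimeBlock c₁)`, across COMPACT walls); brings ★ SPLIT-DOCK, ★ D1c `uniformlyProper_gprimeBlock_cpt_of_ne`, `stabilizer_single_le_centralizer_gprimeBlock_of_wall`, ★ D4a `uniformlyProper_arch_of_places`, `symm_archPiEquivCM_mem_centralizer_gprimeTorus_iff`
import Literature.NumberTheory.Rogawski1990.ArchOrbFamGUnfoldedModel              -- ★ p851098 (F0P3b-p01 (g16)): `archRG_eq_prod_cpt_mul_prod_split`, `contDiff_prod_cptFactor`; brings ★ `orbFamG_apply`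
import Literature.NumberTheory.Rogawski1990.ArchOrbFamGExtBoxDescentInRegG         -- ★ p851168 (LH7-p02 (g4)): (B-desc′) ASSEMBLY `exists_descent_box_orbFamGExt_inRegG_of_corePackage` ((H-cont) + the dock `RegG → InRegG`)
import HarnessLib

/-!
# (B-desc′) (H-core) OFF THE REAL WALLS: box descent of the genuine `G′`-family at a ONE-WALL point whose other compact places are only IN-REGULAR
# (Rogawski 1990 §4.12 Lemma 4.12.1, §8.2 pp. 119–124; Harish-Chandra–van Dijk 1970; Shelstad 1979 §4)

Topic `NumberTheory/Rogawski1990`; namespace `Literature.NumberTheory.Rogawski1990`.  THEOREMS ONLY (no `def`, no instance, no notation, no axiom, no named fact, no `sorry`);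
kernel lane `--kind proof --supports stmt-HodgeConjecture-24833`.  Cell `pub/hodgecm-mathlib`, crux H413 (`stmt-HodgeConjecture-24833`), F0∕P3c line LH3 (closer stub `stub_N9`),
LETTER L1 `HcOrbitalFamiliesStatement`, clause (I₁) FACES; LH3-plan (g3∕g4) RULINGS #17∕#18: brick **(B-desc′) «NON-GENERIC FACE POINTS»**, input **(H-core)** (this seat) of the
assembly ★ p851168 `exists_descent_box_orbFamGExt_inRegG_of_corePackage` (LH7-p02 (g4)).

THE MATHEMATICS.  ★ p851016 (`exists_descent_box_chartOrbG`) proves Rogawski's box descent at a SEMIREGULAR point `p` of the noncompact wall `(w₀, 0, 2)` (the other compact places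
REGULAR).  Its proof uses semiregularity at the other places only to (i) identify the centraliser `Z(γ_p) ≃ B × K` (★ (M-UNFOLD) p850499) and (ii) run Harish-Chandra's compactness
lemma on a box (its §1, ★ SPLIT-DOCK signed «regular elsewhere»).  HERE the base point `x` has the one noncompact coincidence `e^{ix_{w₀0}} = e^{ix_{w₀2}} ≠ e^{ix_{w₀1}}` at `w₀`, is
only IN-REGULAR at the other compact places (compact-wall coincidences `e^{ix_{w i}} = e^{ix_{w j}}`, `s_w i = s_w j`, ALLOWED) and sits OFF the real walls at the split places
(`x_w ≠ 0`, `w ∈ S`).  We descend NOT to `Z(γ_x)` (which grows at a compact coincidence) but to `Z(γ_p)` for the AUXILIARY SEMIREGULAR point `p := x` at `w₀`, REGULAR elsewhere: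
`T_S ≤ Z(γ_p)`, every `γ_c` commutes with it, ★ (M-UNFOLD) applies to `p` verbatim, and the compactness modulo `Z(γ_p)` on a box around `x` holds PLACE BY PLACE — at `w₀` across
the noncompact wall modulo `Stab(e_{τ₀1}) ≤ Z(γ_{p,w₀})` (★ D1c), at every other place on the whole in-regular factor modulo `Z(γ_{p,w}) = Z(γ_{c₁,w})` for a regular reference `c₁`
(★ p850547 `uniformlyProper_gprimeBlock_of_inRegG_place`: at a compact coincidence the stabiliser of the odd line is COMPACT), assembled by ★ D4a.  Everything after §1 is ★ p851016 §2
TOKEN FOR TOKEN with `Z(γ_p)` at the auxiliary `p`.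
* §1 `exists_isCompact_mul_centralizer_box_of_wall_inRegAt` — ONE compact `C″` and an open box `U ∋ x` (slot `1` simple at `w₀`, in-regular at the other compact places, `x_w ≠ 0`
  on `S`) with `y′ γ_c y′⁻¹ ∈ C′ ⇒ y′ ∈ C″ · Z(γ_p)` for all `c ∈ U`.
* §2 **`exists_descent_box_chartOrbG_of_wall_inRegAt`** — ★ p851016's conclusion VERBATIM (`K ≠ 0`, `U ∋ x` open, `f` jointly `C^∞`, uniform matrix support, tangential clause,
  `chartOrbG c = K · ∫_{U(J)} f(c, ↑↑(h · P diag(e^{ic_{w₀0}}, e^{ic_{w₀2}}) P⁻¹ · h⁻¹)) dμ₀` on `U ∩ RegG S`) at the non-generic base point `x`.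
* §4 (ED. 2) **`exists_descent_box_orbFamGExt_inRegG_of_wall_inRegAt`** — the (B-desc′) HEAD for one-wall points off the real walls: §3 fed to ★ p851168's assembly
  `exists_descent_box_orbFamGExt_inRegG_of_corePackage` (LH7-p02 (g4)); the identity for the EXTENDED member `orbFamGExt` at every `c ∈ U` off the `w₀`-wall.
HONEST SCOPE: the split coordinates of `x` stay OFF the real walls (`x_w ≠ 0`); one-wall points ON a real wall need the parabolic unfolding of the split places first (★ (A4′)
`ArchOrbFamGSmoothModelParam` is its engine; the `w₀`-descent-after-unfolding is not typed here).  HONEST LABEL: HC_CM is proved only modulo the 7 printed citations (2 remaining: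
hLiu418 = `stmt-HodgeConjecture-24832`, h413 = `stmt-HodgeConjecture-24833`) until rung 0 closes; count-neutral assembly of ★ bricks.

## References
* [Rogawski1990] J. D. Rogawski, *Automorphic Representations of Unitary Groups in Three Variables*, Ann. of Math. Stud. 123 (1990), §4.12 Lemma 4.12.1 p. 61, §8.2 pp. 119–124.
* [HarishChandra1970] Harish-Chandra (notes by G. van Dijk), *Harmonic Analysis on Reductive p-adic Groups*, LNM 162 (1970), Part V §4 Lemmas 22–23.
* [Shelstad1979] D. Shelstad, *Characters and inner forms of a quasi-split group over ℝ*, Compositio Math. 39 (1979), §4 pp. 22–25.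
* [Varadarajan1977] V. S. Varadarajan, *Harmonic Analysis on Real Reductive Groups*, LNM 576 (1977), Part I §1.12.
* [Bouaziz1994IntegralesOrbitales] A. Bouaziz, *Intégrales orbitales sur les groupes de Lie réductifs*, Ann. Sci. ÉNS 27 (1994), §6.2 p. 591 (`T_{in-reg}`).
-/

set_option autoImplicit false

noncomputable section

open MeasureTheory MeasureTheory.Measure NumberField NumberField.InfinitePlace NumberField.mixedEmbedding Matrix Complex Set Filter Topology
open scoped MatrixGroups Matrix Real Classical ENNReal NNReal ContDiff Matrix.Norms.Operator Pointwise
open Literature.NumberTheory.Automorphic Literature.NumberTheory.Automorphic.UnitaryGroup Literature.NumberTheory.Automorphic.ArchCartan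
open Literature.NumberTheory.GaloisRepresentations Literature.MeasureTheory.Group

namespace Literature.NumberTheory.Rogawski1990

/-! ## §1 Harish-Chandra's compactness on a BOX around the non-generic one-wall point, modulo the centraliser of the auxiliary semiregular point -/

section Box

variable (L : Type) [Field L] [NumberField L] [IsCMField L] (α : Fin 3 → L)
  (S : Finset {w : InfinitePlace L // IsComplex w}) (w₀ : {w : InfinitePlace L // IsComplex w})

omit [IsCMField L] in
/-- **The box conditions are open**: slot `1` simple at `w₀`, in-regular at the other compact places, off the real walls on `S` (finite intersections of `{e^{ic_{w i}} ≠ e^{ic_{w j}}}`,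
`{c_w 0 ≠ 0}`). [cite: Bouaziz1994IntegralesOrbitales, §6.2 p. 591] -/
theorem isOpen_setOf_wallBox :
    IsOpen {c : {w : InfinitePlace L // IsComplex w} → Fin 3 → ℝ |
      (∀ j : Fin 3, j ≠ 1 → Circle.exp (c w₀ 1) ≠ Circle.exp (c w₀ j)) ∧
        (∀ w, w ∉ S → w ≠ w₀ → ∀ i j : Fin 3, i ≠ j → slotSign L α w i ≠ slotSign L α w j → Circle.exp (c w i) ≠ Circle.exp (c w j)) ∧
        (∀ w, w ∈ S → c w 0 ≠ 0)} := by
  have hO1 : IsOpen {c : {w : InfinitePlace L // IsComplex w} → Fin 3 → ℝ | ∀ j : Fin 3, j ≠ 1 → Circle.exp (c w₀ 1) ≠ Circle.exp (c w₀ j)} := by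
    have h : {c : {w : InfinitePlace L // IsComplex w} → Fin 3 → ℝ | ∀ j : Fin 3, j ≠ 1 → Circle.exp (c w₀ 1) ≠ Circle.exp (c w₀ j)} =
        ⋂ j ∈ {j : Fin 3 | j ≠ 1}, {c | Circle.exp (c w₀ 1) ≠ Circle.exp (c w₀ j)} := by
      ext c; simp only [mem_setOf_eq, mem_iInter]
    rw [h]
    exact (Set.toFinite _).isOpen_biInter fun j _ => isOpen_ne_fun (continuous_circleExp_coord w₀ 1) (continuous_circleExp_coord w₀ j)
  have hO2 : IsOpen {c : {w : InfinitePlace L // IsComplex w} → Fin 3 → ℝ |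
      ∀ w, w ∉ S → w ≠ w₀ → ∀ i j : Fin 3, i ≠ j → slotSign L α w i ≠ slotSign L α w j → Circle.exp (c w i) ≠ Circle.exp (c w j)} := by
    have h : {c : {w : InfinitePlace L // IsComplex w} → Fin 3 → ℝ |
          ∀ w, w ∉ S → w ≠ w₀ → ∀ i j : Fin 3, i ≠ j → slotSign L α w i ≠ slotSign L α w j → Circle.exp (c w i) ≠ Circle.exp (c w j)} =
        ⋂ w ∈ {w : {w : InfinitePlace L // IsComplex w} | w ∉ S ∧ w ≠ w₀}, ⋂ q ∈ {q : Fin 3 × Fin 3 | q.1 ≠ q.2 ∧ slotSign L α w q.1 ≠ slotSign L α w q.2},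
          {c | Circle.exp (c w q.1) ≠ Circle.exp (c w q.2)} := by
      ext c
      simp only [mem_setOf_eq, mem_iInter, Prod.forall, and_imp]
    rw [h]
    exact (Set.toFinite _).isOpen_biInter fun w _ => (Set.toFinite _).isOpen_biInter fun q _ =>
      isOpen_ne_fun (continuous_circleExp_coord w q.1) (continuous_circleExp_coord w q.2)
  have hO3 : IsOpen {c : {w : InfinitePlace L // IsComplex w} → Fin 3 → ℝ | ∀ w, w ∈ S → c w 0 ≠ 0} := by
    have h : {c : {w : InfinitePlace L // IsComplex w} → Fin 3 → ℝ | ∀ w, w ∈ S → c w 0 ≠ 0} = ⋂ w ∈ (↑S : Set _), {c | c w 0 ≠ 0} := by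
      ext c; simp only [mem_setOf_eq, mem_iInter, Finset.mem_coe]
    rw [h]
    exact (Set.toFinite _).isOpen_biInter fun w _ =>
      isOpen_ne_fun ((continuous_apply 0).comp (continuous_apply w)) continuous_const
  have h : {c : {w : InfinitePlace L // IsComplex w} → Fin 3 → ℝ |
      (∀ j : Fin 3, j ≠ 1 → Circle.exp (c w₀ 1) ≠ Circle.exp (c w₀ j)) ∧
        (∀ w, w ∉ S → w ≠ w₀ → ∀ i j : Fin 3, i ≠ j → slotSign L α w i ≠ slotSign L α w j → Circle.exp (c w i) ≠ Circle.exp (c w j)) ∧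
        (∀ w, w ∈ S → c w 0 ≠ 0)} =
      {c : {w : InfinitePlace L // IsComplex w} → Fin 3 → ℝ | ∀ j : Fin 3, j ≠ 1 → Circle.exp (c w₀ 1) ≠ Circle.exp (c w₀ j)} ∩
        ({c | ∀ w, w ∉ S → w ≠ w₀ → ∀ i j : Fin 3, i ≠ j → slotSign L α w i ≠ slotSign L α w j → Circle.exp (c w i) ≠ Circle.exp (c w j)} ∩
          {c | ∀ w, w ∈ S → c w 0 ≠ 0}) := by
    ext c; simp only [mem_inter_iff, mem_setOf_eq]
  rw [h]
  exact hO1.inter (hO2.inter hO3)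

/-- **ONE COMPACT `C″` FOR ALL CHART POINTS NEAR A ONE-WALL POINT WITH IN-REGULAR OTHER PLACES, MODULO `Z(γ_p)` AT THE AUXILIARY SEMIREGULAR `p`.**  `p` is semiregular
(wall `e^{ip_{w₀0}} = e^{ip_{w₀2}} ≠ e^{ip_{w₀1}}` at the compact-chart place `w₀ ∉ S`, regular elsewhere, `p_w 0 ≠ 0` on `S`); `x` agrees with `p` at `w₀`, is in-regular at the
other compact places and off the real walls on `S`.  Then there are a compact `C″ ⊆ G′_∞` and an open `U ∋ x` (slot `1` simple at `w₀`, in-regular at the other compact places,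
`c_w 0 ≠ 0` on `S`) with `y′ · gprimeTorus c · y′⁻¹ ∈ C′ ⇒ y′ ∈ C″ · Z(gprimeTorus p)` for EVERY `c ∈ U` — ★ D1c at `w₀` modulo `Stab(e_{τ₀1}) ≤ Z(γ_{p,w₀})`, ★ p850547 at
every other place modulo `Z(γ_{c₁,w}) = Z(γ_{p,w})` (`c₁` regular, `= p` off `w₀`), assembled by ★ D4a and lifted to the group.
[cite: Rogawski1990, §4.12 Lemma 4.12.1 p. 61; §8.2 p. 122] [cite: HarishChandra1970, Part V §4 Lemma 22] [cite: Shelstad1979, §4 pp. 22–25] -/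
theorem exists_isCompact_mul_centralizer_box_of_wall_inRegAt (hα : ∀ i, α i ≠ 0)
    (hreal : ∀ (w : {w : InfinitePlace L // IsComplex w}) (i : Fin 3), (w.1.embedding (α i)).im = 0)
    (hS : ∀ w, w ∈ S → w ∈ splitChartPlaces L α) (hw₀ : w₀ ∉ S)
    (p x : {w : InfinitePlace L // IsComplex w} → Fin 3 → ℝ) (hxp : x w₀ = p w₀)
    (h02 : Circle.exp (p w₀ 0) = Circle.exp (p w₀ 2)) (h01 : Circle.exp (p w₀ 0) ≠ Circle.exp (p w₀ 1))
    (hreg : ∀ w, w ≠ w₀ → w ∉ S → Function.Injective fun i : Fin 3 => Circle.exp (p w i)) (hregS : ∀ w, w ∈ S → p w 0 ≠ 0)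
    (hxin : ∀ w, w ∉ S → w ≠ w₀ → ∀ i j : Fin 3, i ≠ j → slotSign L α w i ≠ slotSign L α w j → Circle.exp (x w i) ≠ Circle.exp (x w j))
    (hxS : ∀ w, w ∈ S → x w 0 ≠ 0)
    {C' : Set ↥(arch (↥(maximalRealSubfield L)) L (IsCMField.complexConj L) 3 (Matrix.diagonal α))} (hC' : IsCompact C') :
    ∃ (C'' : Set ↥(arch (↥(maximalRealSubfield L)) L (IsCMField.complexConj L) 3 (Matrix.diagonal α))) (U : Set ({w : InfinitePlace L // IsComplex w} → Fin 3 → ℝ)),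
      IsCompact C'' ∧ IsOpen U ∧ x ∈ U ∧
      (∀ c ∈ U, ∀ j : Fin 3, j ≠ 1 → Circle.exp (c w₀ 1) ≠ Circle.exp (c w₀ j)) ∧
      (∀ c ∈ U, ∀ w, w ∉ S → w ≠ w₀ → ∀ i j : Fin 3, i ≠ j → slotSign L α w i ≠ slotSign L α w j → Circle.exp (c w i) ≠ Circle.exp (c w j)) ∧
      (∀ c ∈ U, ∀ w, w ∈ S → c w 0 ≠ 0) ∧
      ∀ c ∈ U, ∀ y' : ↥(arch (↥(maximalRealSubfield L)) L (IsCMField.complexConj L) 3 (Matrix.diagonal α)),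
        y' * gprimeTorus L α S c * y'⁻¹ ∈ C' →
          y' ∈ C'' * ((Subgroup.centralizer ({gprimeTorus L α S p} : Set ↥(arch (↥(maximalRealSubfield L)) L (IsCMField.complexConj L) 3 (Matrix.diagonal α)))) :
            Set ↥(arch (↥(maximalRealSubfield L)) L (IsCMField.complexConj L) 3 (Matrix.diagonal α))) := by
  have hw₀' : ¬ (w₀ ∈ S ∧ w₀ ∈ splitChartPlaces L α) := fun h => hw₀ h.1
  -- the open box `V ∋ x`
  obtain ⟨V, hVdef⟩ : ∃ V : Set ({w : InfinitePlace L // IsComplex w} → Fin 3 → ℝ), V =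
      {c | (∀ j : Fin 3, j ≠ 1 → Circle.exp (c w₀ 1) ≠ Circle.exp (c w₀ j)) ∧
        (∀ w, w ∉ S → w ≠ w₀ → ∀ i j : Fin 3, i ≠ j → slotSign L α w i ≠ slotSign L α w j → Circle.exp (c w i) ≠ Circle.exp (c w j)) ∧
        (∀ w, w ∈ S → c w 0 ≠ 0)} := ⟨_, rfl⟩
  have hVo : IsOpen V := by rw [hVdef]; exact isOpen_setOf_wallBox L α S w₀
  have hxV : x ∈ V := by
    rw [hVdef]
    refine ⟨fun j hj => ?_, hxin, hxS⟩
    rw [hxp]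
    fin_cases j
    · exact fun h => h01 h.symm
    · exact absurd rfl hj
    · exact fun h => h01 (h02.trans h.symm)
  obtain ⟨ε, hε, hball⟩ := Metric.isOpen_iff.1 hVo x hxV
  have hKc : IsCompact (Metric.closedBall x (ε / 2)) := isCompact_closedBall x (ε / 2)
  have hKV : Metric.closedBall x (ε / 2) ⊆ V := (Metric.closedBall_subset_ball (by linarith)).trans hball
  -- a REGULAR reference point `c₁` agreeing with `p` off `w₀`
  obtain ⟨c₀, hc₀⟩ := (dense_regG S).nonempty
  obtain ⟨c₁, hc₁def⟩ : ∃ c₁ : {w : InfinitePlace L // IsComplex w} → Fin 3 → ℝ, c₁ = Function.update p w₀ (c₀ w₀) := ⟨_, rfl⟩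
  have hc₁w : ∀ w, w ≠ w₀ → c₁ w = p w := fun w hw => by rw [hc₁def, Function.update_of_ne hw]
  have hc₁ : c₁ ∈ RegG S := by
    rw [mem_regG_iff]
    refine ⟨fun w hw => ?_, fun w hw => ?_⟩
    · by_cases hww : w = w₀
      · subst hww
        rw [hc₁def, Function.update_self]
        exact ((mem_regG_iff S c₀).1 hc₀).1 w hw
      · rw [hc₁w w hww]
        exact hreg w hww hw
    · have hww : w ≠ w₀ := fun h => hw₀ (h ▸ hw)
      rw [hc₁w w hww]
      exact hregS w hw
  have hblk : ∀ w, w ≠ w₀ → gprimeBlock L α w S c₁ = gprimeBlock L α w S p := fun w hw => gprimeBlock_congr_place L α S w (hc₁w w hw)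
  -- per-place parameter sets
  let T : {w : InfinitePlace L // IsComplex w} → Set (Fin 3 → ℝ) := fun w =>
    {cw | (w = w₀ → ∀ j : Fin 3, j ≠ 1 → Circle.exp (cw 1) ≠ Circle.exp (cw j)) ∧
      (w ≠ w₀ → (w ∈ S → cw 0 ≠ 0) ∧ (w ∉ S → ∀ i j : Fin 3, i ≠ j → slotSign L α w i ≠ slotSign L α w j → Circle.exp (cw i) ≠ Circle.exp (cw j)))}
  have hwall : ∀ j j' : Fin 3, j ≠ 1 → j' ≠ 1 → Circle.exp (p w₀ j) = Circle.exp (p w₀ j') := by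
    have hkey : ∀ j : Fin 3, j ≠ 1 → Circle.exp (p w₀ j) = Circle.exp (p w₀ 0) := by
      intro j hj
      fin_cases j
      · rfl
      · exact absurd rfl hj
      · exact h02.symm
    exact fun j j' hj hj' => (hkey j hj).trans (hkey j' hj').symm
  -- per-place (HYP) modulo `Z(gprimeBlock w S p)`
  have hprop : ∀ w : {w : InfinitePlace L // IsComplex w}, ∀ K ⊆ T w, IsCompact K → ∀ C : Set ↥(archLocal L 3 (Matrix.diagonal α) w), IsCompact C →
      ∃ 𝒦 : Set (↥(archLocal L 3 (Matrix.diagonal α) w) ⧸ Subgroup.centralizer ({gprimeBlock L α w S p} : Set ↥(archLocal L 3 (Matrix.diagonal α) w))),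
        IsCompact 𝒦 ∧ ∀ cw ∈ K, ∀ y : ↥(archLocal L 3 (Matrix.diagonal α) w), y * gprimeBlock L α w S (fun _ => cw) * y⁻¹ ∈ C →
          (QuotientGroup.mk y : ↥(archLocal L 3 (Matrix.diagonal α) w) ⧸ Subgroup.centralizer ({gprimeBlock L α w S p} : Set ↥(archLocal L 3 (Matrix.diagonal α) w))) ∈ 𝒦 := by
    intro w
    by_cases hw : w = w₀
    · subst hw
      exact uniformlyProper_mono _ _ (fun cw hcw => hcw.1 rfl)
        (uniformlyProper_gprimeBlock_cpt_of_ne L α S hα (hreal w) hw₀' 1 _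
          (stabilizer_single_le_centralizer_gprimeBlock_of_wall L α S hα (hreal w) hw₀' 1 p hwall))
    · have h := uniformlyProper_gprimeBlock_of_inRegG_place L α S hα hreal hS hc₁ w
      rw [hblk w hw] at h
      exact uniformlyProper_mono _ _ (fun cw hcw => hcw.2 hw) h
  -- assembly over the places on the compact ball
  have hKT : Metric.closedBall x (ε / 2) ⊆ Set.pi Set.univ T := by
    intro c hc w _
    have hcV : c ∈ V := hKV hc
    rw [hVdef] at hcV
    refine ⟨fun hw => ?_, fun hw => ⟨fun hwS => hcV.2.2 w hwS, fun hwS => hcV.2.1 w hwS hw⟩⟩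
    subst hw
    exact hcV.1
  obtain ⟨𝒦', h𝒦', hmem⟩ := uniformlyProper_arch_of_places L 3 (Matrix.diagonal α)
    (fun w => Subgroup.centralizer ({gprimeBlock L α w S p} : Set ↥(archLocal L 3 (Matrix.diagonal α) w)))
    (Subgroup.centralizer ({gprimeTorus L α S p} : Set _)) (symm_archPiEquivCM_mem_centralizer_gprimeTorus_iff L α S p)
    (fun w cw => gprimeBlock L α w S (fun _ => cw)) T hprop _ hKT hKc C' hC'
  obtain ⟨C'', hC'', hsub⟩ := exists_isCompact_image_mk_superset
    (Subgroup.centralizer ({gprimeTorus L α S p} : Set ↥(arch (↥(maximalRealSubfield L)) L (IsCMField.complexConj L) 3 (Matrix.diagonal α)))) h𝒦'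
  refine ⟨C'', Metric.ball x (ε / 2), hC'', Metric.isOpen_ball, Metric.mem_ball_self (half_pos hε), fun c hc => ?_, fun c hc => ?_, fun c hc => ?_, ?_⟩
  · have hcV : c ∈ V := hKV (Metric.ball_subset_closedBall hc)
    rw [hVdef] at hcV
    exact hcV.1
  · have hcV : c ∈ V := hKV (Metric.ball_subset_closedBall hc)
    rw [hVdef] at hcV
    exact hcV.2.1
  · have hcV : c ∈ V := hKV (Metric.ball_subset_closedBall hc)
    rw [hVdef] at hcV
    exact hcV.2.2
  intro c hc y' hy'
  rw [gprimeTorus_eq_symm_blockChart] at hy'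
  obtain ⟨a, ha, hay⟩ := hsub (hmem _ (Metric.ball_subset_closedBall hc) y' hy')
  rw [QuotientGroup.eq] at hay
  exact ⟨a, ha, a⁻¹ * y', hay, by group⟩

/-- **The split-place normalising factor `Δ_w(c) = |eˣ − e⁻ˣ|·|e^{x+iθ} − e^{iφ}|·|e^{−x+iθ} − e^{iφ}|`, smoothly CUT OFF near a point `x_w ≠ 0`, is `C^∞` on the whole coordinate space**:
`c ↦ β(c_w 0) · Δ_w(c)` with `β` a bump around `x_w 0` supported in `{t ≠ 0}` — smooth where `c_w 0 ≠ 0` (`Δ_w` has no zero there: ★ `cexp_add_mul_I_sub_cexp_mul_I_ne_zero`, Mathlib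
`contDiffAt_norm`) and locally zero where `c_w 0 = 0`. [cite: Shelstad1979, §4 p. 22] [cite: Rogawski1990, §8.2 p. 118] -/
theorem contDiff_bump_mul_splitFactor {W : Type*} [Fintype W] (w : W) {t₀ : ℝ} (β : ContDiffBump t₀) (hβ : β.rOut < |t₀|) :
    ContDiff ℝ ∞ fun c : W → Fin 3 → ℝ =>
      (((β (c w 0) * (|Real.exp (c w 0) - Real.exp (-c w 0)| *
          ‖Complex.exp (c w 0 + c w 2 * I) - Complex.exp (c w 1 * I)‖ * ‖Complex.exp (-c w 0 + c w 2 * I) - Complex.exp (c w 1 * I)‖) : ℝ) : ℂ)) := by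
  refine ofRealCLM.contDiff.comp (contDiff_iff_contDiffAt.2 fun c => ?_)
  have hl : ∀ j : Fin 3, ContDiff ℝ ∞ fun c : W → Fin 3 → ℝ => ((c w j : ℝ) : ℂ) := fun j =>
    ofRealCLM.contDiff.comp (contDiff_apply_apply ℝ ℝ w j)
  have hβc : ContDiff ℝ ∞ fun c : W → Fin 3 → ℝ => β (c w 0) := β.contDiff.comp (contDiff_apply_apply ℝ ℝ w 0)
  by_cases hc : c w 0 = 0
  · -- near a point with `c_w 0 = 0` the bump factor vanishes identically
    have h0 : (fun c : W → Fin 3 → ℝ => β (c w 0) * (|Real.exp (c w 0) - Real.exp (-c w 0)| *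
        ‖Complex.exp (c w 0 + c w 2 * I) - Complex.exp (c w 1 * I)‖ * ‖Complex.exp (-c w 0 + c w 2 * I) - Complex.exp (c w 1 * I)‖)) =ᶠ[𝓝 c] fun _ => 0 := by
      have hopen : IsOpen ((fun c' : W → Fin 3 → ℝ => c' w 0) ⁻¹' Metric.closedBall t₀ β.rOut)ᶜ :=
        (Metric.isClosed_closedBall.preimage ((continuous_apply 0).comp (continuous_apply w))).isOpen_compl
      have hmem : c ∈ ((fun c' : W → Fin 3 → ℝ => c' w 0) ⁻¹' Metric.closedBall t₀ β.rOut)ᶜ := by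
        rw [Set.mem_compl_iff, Set.mem_preimage, hc, Metric.mem_closedBall, dist_zero_left, Real.norm_eq_abs]
        exact not_le.2 hβ
      filter_upwards [hopen.mem_nhds hmem] with c' hc'
      have hz : β (c' w 0) = 0 := by
        have h := β.tsupport_eq
        by_contra hne
        exact hc' (h ▸ subset_tsupport _ hne)
      rw [hz, zero_mul]
    exact (contDiffAt_const.congr_of_eventuallyEq h0)
  · -- where `c_w 0 ≠ 0` every factor is smooth
    have h1 : ContDiffAt ℝ ∞ (fun c : W → Fin 3 → ℝ => |Real.exp (c w 0) - Real.exp (-c w 0)|) c := by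
      have hne : Real.exp (c w 0) - Real.exp (-c w 0) ≠ 0 := by
        intro h
        have h' : c w 0 = -c w 0 := Real.exp_injective (sub_eq_zero.1 h)
        exact hc (by linarith)
      have hg : ContDiff ℝ ∞ fun c : W → Fin 3 → ℝ => Real.exp (c w 0) - Real.exp (-c w 0) :=
        (Real.contDiff_exp.comp (contDiff_apply_apply ℝ ℝ w 0)).sub (Real.contDiff_exp.comp (contDiff_apply_apply ℝ ℝ w 0).neg)
      have hn := (contDiffAt_norm ℝ hne).comp c hg.contDiffAt
      simpa only [Function.comp_def, Real.norm_eq_abs] using hn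
    have h2 : ContDiffAt ℝ ∞ (fun c : W → Fin 3 → ℝ => ‖Complex.exp (c w 0 + c w 2 * I) - Complex.exp (c w 1 * I)‖) c := by
      have hne : Complex.exp ((c w 0 : ℂ) + (c w 2 : ℂ) * I) - Complex.exp ((c w 1 : ℂ) * I) ≠ 0 := cexp_add_mul_I_sub_cexp_mul_I_ne_zero hc _ _
      have hg : ContDiff ℝ ∞ fun c : W → Fin 3 → ℝ => Complex.exp ((c w 0 : ℂ) + (c w 2 : ℂ) * I) - Complex.exp ((c w 1 : ℂ) * I) :=
        (Complex.contDiff_exp.comp ((hl 0).add ((hl 2).mul contDiff_const))).sub (Complex.contDiff_exp.comp ((hl 1).mul contDiff_const))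
      exact (contDiffAt_norm ℝ hne).comp c hg.contDiffAt
    have h3 : ContDiffAt ℝ ∞ (fun c : W → Fin 3 → ℝ => ‖Complex.exp (-c w 0 + c w 2 * I) - Complex.exp (c w 1 * I)‖) c := by
      have hne : Complex.exp (((-c w 0 : ℝ) : ℂ) + (c w 2 : ℂ) * I) - Complex.exp ((c w 1 : ℂ) * I) ≠ 0 :=
        cexp_add_mul_I_sub_cexp_mul_I_ne_zero (neg_ne_zero.2 hc) _ _
      rw [Complex.ofReal_neg] at hne
      have hg : ContDiff ℝ ∞ fun c : W → Fin 3 → ℝ => Complex.exp (-(c w 0 : ℂ) + (c w 2 : ℂ) * I) - Complex.exp ((c w 1 : ℂ) * I) :=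
        (Complex.contDiff_exp.comp ((hl 0).neg.add ((hl 2).mul contDiff_const))).sub (Complex.contDiff_exp.comp ((hl 1).mul contDiff_const))
      exact (contDiffAt_norm ℝ hne).comp c hg.contDiffAt
    exact hβc.contDiffAt.mul ((h1.mul h2).mul h3)


end Box

/-! ## §2 The descent identity on the box around the non-generic one-wall point (★ p851016 §2 with `Z(γ_p)` at the auxiliary semiregular `p`) -/

section Chart

variable (L : Type) [Field L] [NumberField L] [IsCMField L] (α : Fin 3 → L)
  [MeasurableSpace ↥(arch (↥(maximalRealSubfield L)) L (IsCMField.complexConj L) 3 (Matrix.diagonal α))]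
  [BorelSpace ↥(arch (↥(maximalRealSubfield L)) L (IsCMField.complexConj L) 3 (Matrix.diagonal α))]
  (ν' : Measure ↥(arch (↥(maximalRealSubfield L)) L (IsCMField.complexConj L) 3 (Matrix.diagonal α))) [ν'.IsHaarMeasure] [ν'.IsMulRightInvariant]

set_option maxHeartbeats 1600000 in
/-- **(B-desc′) (H-core) OFF THE REAL WALLS, `chartOrbG` FORM.**  House frame, admissible compact chart `S`, covered compact place `w₀ ∉ S`; an AUXILIARY SEMIREGULAR point `p`
(wall `e^{ip_{w₀0}} = e^{ip_{w₀2}} ≠ e^{ip_{w₀1}}`, regular at the other compact places, `p_w 0 ≠ 0` on `S`) and the BASE POINT `x` with `x_{w₀} = p_{w₀}`, IN-REGULAR at the other compact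
places (compact-wall coincidences allowed) and OFF the real walls on `S`; `a′ ∈ C_c^∞(G′_∞)`, any Haar `μ₀` on `U(J)`.  THEN ★ p851016's conclusion holds AT `x`: `K ≠ 0`, an open `U ∋ x`, a
JOINTLY SMOOTH family `f`, compactly supported in the matrix variable uniformly in `c`, depending on `c` only through `update c w₀ (0, c_{w₀1}, 0)`, with
**`chartOrbG L α ν′ S a′ c = K · ∫_{U(J)} f(c, ↑↑(h · P diag(e^{i c_{w₀0}}, e^{i c_{w₀2}}) P⁻¹ · h⁻¹)) dμ₀(h)`** for every `c ∈ U ∩ RegG S` — ★ p851016 §2 TOKEN FOR TOKEN with the descent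
group `Z(γ_p)` of the auxiliary `p` (★ (M-UNFOLD) p850499 at `p`) and §1 for the compactness on the box around `x`.
[cite: Rogawski1990, §4.12 Lemma 4.12.1 p. 61; §8.2 pp. 119–124] [cite: HarishChandra1970, Part V §4 Lemma 22] [cite: Shelstad1979, §4 Lemma 4.3 (p. 25)] -/
theorem exists_descent_box_chartOrbG_of_wall_inRegAt (hα : ∀ i, α i ≠ 0)
    (hreal : ∀ (w : {w : InfinitePlace L // IsComplex w}) (i : Fin 3), (w.1.embedding (α i)).im = 0)
    {J : Matrix (Fin 2) (Fin 2) ℂ} (hJ : J = (StdForm.antidiagonal 2).over ℂ)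
    [MeasurableSpace ↥(unitaryGroupOfForm (starRingEnd ℂ) J)] [BorelSpace ↥(unitaryGroupOfForm (starRingEnd ℂ) J)]
    [LocallyCompactSpace ↥(unitaryGroupOfForm (starRingEnd ℂ) J)] [SecondCountableTopology ↥(unitaryGroupOfForm (starRingEnd ℂ) J)]
    (μ₀ : Measure ↥(unitaryGroupOfForm (starRingEnd ℂ) J)) [μ₀.IsHaarMeasure] [μ₀.IsMulRightInvariant]
    {S : Finset {w : InfinitePlace L // IsComplex w}} {w₀ : {w : InfinitePlace L // IsComplex w}} {p x : {w : InfinitePlace L // IsComplex w} → Fin 3 → ℝ}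
    (hS : ∀ w, w ∈ S → w ∈ splitChartPlaces L α) (hw₀ : w₀ ∉ S) (hwsp : w₀ ∈ splitChartPlaces L α) (hxp : x w₀ = p w₀)
    (h02c : Circle.exp (p w₀ 0) = Circle.exp (p w₀ 2)) (h01 : Circle.exp (p w₀ 0) ≠ Circle.exp (p w₀ 1))
    (hreg : ∀ w, w ≠ w₀ → w ∉ S → Function.Injective fun i : Fin 3 => Circle.exp (p w i)) (hregS : ∀ w, w ∈ S → p w 0 ≠ 0)
    (hxin : ∀ w, w ∉ S → w ≠ w₀ → ∀ i j : Fin 3, i ≠ j → slotSign L α w i ≠ slotSign L α w j → Circle.exp (x w i) ≠ Circle.exp (x w j))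
    (hxS : ∀ w, w ∈ S → x w 0 ≠ 0)
    {a' : ↥(arch (↥(maximalRealSubfield L)) L (IsCMField.complexConj L) 3 (Matrix.diagonal α)) → ℂ} (ha' : ArchSmooth L 3 (Matrix.diagonal α) a') :
    ∃ (K : ℂ) (U : Set ({w : InfinitePlace L // IsComplex w} → Fin 3 → ℝ)) (f : ({w : InfinitePlace L // IsComplex w} → Fin 3 → ℝ) × Matrix (Fin 2) (Fin 2) ℂ → ℂ),
      K ≠ 0 ∧ IsOpen U ∧ x ∈ U ∧ ContDiff ℝ ∞ f ∧
      (∃ C : Set (Matrix (Fin 2) (Fin 2) ℂ), IsCompact C ∧ ∀ c X, X ∉ C → f (c, X) = 0) ∧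
      (∀ c X, f (c, X) = f (Function.update c w₀ ![0, c w₀ 1, 0], X)) ∧
      ∀ c ∈ U ∩ RegG S, chartOrbG L α ν' S a' c =
        K * ∫ h : ↥(unitaryGroupOfForm (starRingEnd ℂ) J),
          f (c, (((h * ⟨Matrix.GeneralLinearGroup.mkOfDetNeZero !![(1 : ℂ), 1; 1, -1] det_cayleyTwo_ne_zero *
                circleDiagonal 2 ![Circle.exp (c w₀ 0), Circle.exp (c w₀ 2)] *
                (Matrix.GeneralLinearGroup.mkOfDetNeZero !![(1 : ℂ), 1; 1, -1] det_cayleyTwo_ne_zero)⁻¹,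
              cayley_conj_circleDiagonal_mem_of_eq_over hJ _⟩ * h⁻¹ : ↥(unitaryGroupOfForm (starRingEnd ℂ) J)) : GL (Fin 2) ℂ) : Matrix (Fin 2) (Fin 2) ℂ)) ∂μ₀ := by
  -- ### frame facts
  have ha'c : Continuous a' := ha'.continuous
  have ha's : HasCompactSupport a' := ha'.hasCompactSupport
  obtain ⟨hreal2, hsgn⟩ := blockWeights_of_mem_splitChartPlaces L α w₀ hwsp
  -- ### (M-UNFOLD), explicit edition (★ p850499): `e : Z(γ_p) ≃ₜ* B × K` with clauses [4]–[10]
  refine (exists_continuousMulEquiv_centralizer_gprimeTorus_semireg_explicit L α S w₀ hα hS hw₀ p h02c h01 hreg hregS).elim fun K hK => hK.elim fun e he => ?_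
  obtain ⟨hKc, hKsub, hKcomm, h4, h5, h6, hmapT, h8, h9, h10⟩ := he
  -- ### (B-STD) package: `φ`, `e′`, `Ψ` (★ `exists_std_package`)
  refine (exists_std_package L α w₀ hJ hreal2 hsgn e _ _ hmapT).elim fun φ hφ => hφ.elim fun e' hY => hY.elim fun Ψ hZ => ?_
  have hφ := hZ.1
  have hval := hZ.2.1
  have he' := hZ.2.2.1
  have hmapT' := hZ.2.2.2.1
  have hmem := hZ.2.2.2.2.1
  have hΨ := hZ.2.2.2.2.2.2
  -- ### the chart torus sits inside `Z(γ_p)`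
  have hT : chartTorusG L α S ≤ Subgroup.centralizer ({gprimeTorus L α S p} : Set ↥(arch (↥(maximalRealSubfield L)) L (IsCMField.complexConj L) 3 (Matrix.diagonal α))) :=
    chartTorusG_le_centralizer L α S p
  -- ### instances on `Z(γ_p)`, its quotient, `K`, `U(J) ⧸ φ(A)`
  have hZc : IsClosed ((Subgroup.centralizer ({gprimeTorus L α S p} : Set ↥(arch (↥(maximalRealSubfield L)) L (IsCMField.complexConj L) 3 (Matrix.diagonal α)))) :
      Set ↥(arch (↥(maximalRealSubfield L)) L (IsCMField.complexConj L) 3 (Matrix.diagonal α))) := isClosed_centralizer_singleton_of_t2 _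
  haveI : LocallyCompactSpace ↥(Subgroup.centralizer ({gprimeTorus L α S p} : Set ↥(arch (↥(maximalRealSubfield L)) L (IsCMField.complexConj L) 3 (Matrix.diagonal α)))) := hZc.isClosedEmbedding_subtypeVal.locallyCompactSpace
  haveI : SecondCountableTopology ↥(Subgroup.centralizer ({gprimeTorus L α S p} : Set ↥(arch (↥(maximalRealSubfield L)) L (IsCMField.complexConj L) 3 (Matrix.diagonal α)))) := TopologicalSpace.Subtype.secondCountableTopology _
  letI : MeasurableSpace (↥(Subgroup.centralizer ({gprimeTorus L α S p} : Set ↥(arch (↥(maximalRealSubfield L)) L (IsCMField.complexConj L) 3 (Matrix.diagonal α)))) ⧸ (chartTorusG L α S).subgroupOf (Subgroup.centralizer ({gprimeTorus L α S p} : Set ↥(arch (↥(maximalRealSubfield L)) L (IsCMField.complexConj L) 3 (Matrix.diagonal α))))) := borel _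
  haveI : BorelSpace (↥(Subgroup.centralizer ({gprimeTorus L α S p} : Set ↥(arch (↥(maximalRealSubfield L)) L (IsCMField.complexConj L) 3 (Matrix.diagonal α)))) ⧸ (chartTorusG L α S).subgroupOf (Subgroup.centralizer ({gprimeTorus L α S p} : Set ↥(arch (↥(maximalRealSubfield L)) L (IsCMField.complexConj L) 3 (Matrix.diagonal α))))) := ⟨rfl⟩
  haveI : LocallyCompactSpace ↥K := hKc.isClosedEmbedding_subtypeVal.locallyCompactSpace
  haveI : SecondCountableTopology ↥K := TopologicalSpace.Subtype.secondCountableTopology _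
  letI : MeasurableSpace ↥K := borel _
  haveI : BorelSpace ↥K := ⟨rfl⟩
  letI : MeasurableSpace (↥(unitaryGroupOfForm (starRingEnd ℂ) J) ⧸ Subgroup.map (φ : ↥(unitaryGroupOfForm (starRingEnd ℂ) ((Matrix.diagonal ![α (lineOf (formSign L α w₀) 0), α (lineOf (formSign L α w₀) 2)]).map w₀.1.embedding)) →* ↥(unitaryGroupOfForm (starRingEnd ℂ) J)) ((circleDiagonal 2).codRestrict (unitaryGroupOfForm (starRingEnd ℂ) ((Matrix.diagonal ![α (lineOf (formSign L α w₀) 0), α (lineOf (formSign L α w₀) 2)]).map w₀.1.embedding)) (circleDiagonal_mem_archLocal_diagonal L 2 ![α (lineOf (formSign L α w₀) 0), α (lineOf (formSign L α w₀) 2)] w₀)).range) := borel _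
  haveI : BorelSpace (↥(unitaryGroupOfForm (starRingEnd ℂ) J) ⧸ Subgroup.map (φ : ↥(unitaryGroupOfForm (starRingEnd ℂ) ((Matrix.diagonal ![α (lineOf (formSign L α w₀) 0), α (lineOf (formSign L α w₀) 2)]).map w₀.1.embedding)) →* ↥(unitaryGroupOfForm (starRingEnd ℂ) J)) ((circleDiagonal 2).codRestrict (unitaryGroupOfForm (starRingEnd ℂ) ((Matrix.diagonal ![α (lineOf (formSign L α w₀) 0), α (lineOf (formSign L α w₀) 2)]).map w₀.1.embedding)) (circleDiagonal_mem_archLocal_diagonal L 2 ![α (lineOf (formSign L α w₀) 0), α (lineOf (formSign L α w₀) 2)] w₀)).range) := ⟨rfl⟩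
  haveI : CompactSpace ↥(Subgroup.map (φ : ↥(unitaryGroupOfForm (starRingEnd ℂ) ((Matrix.diagonal ![α (lineOf (formSign L α w₀) 0), α (lineOf (formSign L α w₀) 2)]).map w₀.1.embedding)) →* ↥(unitaryGroupOfForm (starRingEnd ℂ) J)) ((circleDiagonal 2).codRestrict (unitaryGroupOfForm (starRingEnd ℂ) ((Matrix.diagonal ![α (lineOf (formSign L α w₀) 0), α (lineOf (formSign L α w₀) 2)]).map w₀.1.embedding)) (circleDiagonal_mem_archLocal_diagonal L 2 ![α (lineOf (formSign L α w₀) 0), α (lineOf (formSign L α w₀) 2)] w₀)).range) := isCompact_iff_compactSpace.mp (isCompact_map_circleDiagonal_range L α w₀ φ)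
  have hAcomm : ∀ a b : ↥(Subgroup.map (φ : ↥(unitaryGroupOfForm (starRingEnd ℂ) ((Matrix.diagonal ![α (lineOf (formSign L α w₀) 0), α (lineOf (formSign L α w₀) 2)]).map w₀.1.embedding)) →* ↥(unitaryGroupOfForm (starRingEnd ℂ) J)) ((circleDiagonal 2).codRestrict (unitaryGroupOfForm (starRingEnd ℂ) ((Matrix.diagonal ![α (lineOf (formSign L α w₀) 0), α (lineOf (formSign L α w₀) 2)]).map w₀.1.embedding)) (circleDiagonal_mem_archLocal_diagonal L 2 ![α (lineOf (formSign L α w₀) 0), α (lineOf (formSign L α w₀) 2)] w₀)).range), a * b = b * a := by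
    rintro ⟨_, ⟨x, ⟨u, rfl⟩, rfl⟩⟩ ⟨_, ⟨y, ⟨v, rfl⟩, rfl⟩⟩
    apply Subtype.ext
    show (φ : ↥(unitaryGroupOfForm (starRingEnd ℂ) ((Matrix.diagonal ![α (lineOf (formSign L α w₀) 0), α (lineOf (formSign L α w₀) 2)]).map w₀.1.embedding)) →* ↥(unitaryGroupOfForm (starRingEnd ℂ) J)) _ * (φ : ↥(unitaryGroupOfForm (starRingEnd ℂ) ((Matrix.diagonal ![α (lineOf (formSign L α w₀) 0), α (lineOf (formSign L α w₀) 2)]).map w₀.1.embedding)) →* ↥(unitaryGroupOfForm (starRingEnd ℂ) J)) _ =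
      (φ : ↥(unitaryGroupOfForm (starRingEnd ℂ) ((Matrix.diagonal ![α (lineOf (formSign L α w₀) 0), α (lineOf (formSign L α w₀) 2)]).map w₀.1.embedding)) →* ↥(unitaryGroupOfForm (starRingEnd ℂ) J)) _ * (φ : ↥(unitaryGroupOfForm (starRingEnd ℂ) ((Matrix.diagonal ![α (lineOf (formSign L α w₀) 0), α (lineOf (formSign L α w₀) 2)]).map w₀.1.embedding)) →* ↥(unitaryGroupOfForm (starRingEnd ℂ) J)) _
    rw [← map_mul, ← map_mul, ← map_mul, ← map_mul, mul_comm u v]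
  -- ### a right- and inversion-invariant Haar measure on `Z(γ_p)` (★ p850728)
  obtain ⟨νM, hνM1, hνM2, hνM3⟩ := exists_isHaarMeasure_isMulRightInvariant_isInvInvariant_centralizer_arch (↥(maximalRealSubfield L)) L (IsCMField.complexConj L) 3
    (Matrix.diagonal α) ({gprimeTorus L α S p} : Set ↥(arch (↥(maximalRealSubfield L)) L (IsCMField.complexConj L) 3 (Matrix.diagonal α))) K hKc hKcomm e' μ₀
  haveI := hνM1; haveI := hνM2; haveI := hνM3
  -- ### the descent scalar `κ`: `Ψ_*(νM ∕ dt′) = κ • π_* μ₀` (★ `exists_smul_map_mk_of_block_compact`)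
  haveI := isHaarMeasure_chartHaarG L α S
  haveI := isInvInvariant_chartHaarG L α S
  haveI := isHaarMeasure_map_subgroupOfEquivOfLe_symm hT (chartHaarG L α S)
  haveI := isInvInvariant_map_subgroupOfEquivOfLe_symm hT (chartHaarG L α S)
  have hTc := isClosed_subgroupOf_of_isClosed _ (Subgroup.centralizer ({gprimeTorus L α S p} : Set ↥(arch (↥(maximalRealSubfield L)) L (IsCMField.complexConj L) 3 (Matrix.diagonal α))))
    (isClosed_chartTorusG L α S)
  have hAcpt : IsCompact ((Subgroup.map (φ : ↥(unitaryGroupOfForm (starRingEnd ℂ) ((Matrix.diagonal ![α (lineOf (formSign L α w₀) 0), α (lineOf (formSign L α w₀) 2)]).map w₀.1.embedding)) →* ↥(unitaryGroupOfForm (starRingEnd ℂ) J)) ((circleDiagonal 2).codRestrict (unitaryGroupOfForm (starRingEnd ℂ) ((Matrix.diagonal ![α (lineOf (formSign L α w₀) 0), α (lineOf (formSign L α w₀) 2)]).map w₀.1.embedding)) (circleDiagonal_mem_archLocal_diagonal L 2 ![α (lineOf (formSign L α w₀) 0), α (lineOf (formSign L α w₀) 2)] w₀)).range) :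
      Set ↥(unitaryGroupOfForm (starRingEnd ℂ) J)) := isCompact_iff_compactSpace.mpr inferInstance
  have hA : IsClosed ((Subgroup.map (φ : ↥(unitaryGroupOfForm (starRingEnd ℂ) ((Matrix.diagonal ![α (lineOf (formSign L α w₀) 0), α (lineOf (formSign L α w₀) 2)]).map w₀.1.embedding)) →* ↥(unitaryGroupOfForm (starRingEnd ℂ) J)) ((circleDiagonal 2).codRestrict (unitaryGroupOfForm (starRingEnd ℂ) ((Matrix.diagonal ![α (lineOf (formSign L α w₀) 0), α (lineOf (formSign L α w₀) 2)]).map w₀.1.embedding)) (circleDiagonal_mem_archLocal_diagonal L 2 ![α (lineOf (formSign L α w₀) 0), α (lineOf (formSign L α w₀) 2)] w₀)).range) :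
      Set ↥(unitaryGroupOfForm (starRingEnd ℂ) J)) := hAcpt.isClosed
  letI : CommGroup ↥K := { (inferInstance : Group ↥K) with mul_comm := fun a b => Subtype.ext (hKcomm _ a.2 _ b.2) }
  let νK : Measure ↥K := haarMeasure (Classical.arbitrary (TopologicalSpace.PositiveCompacts ↥K))
  haveI : νK.IsInvInvariant := IsHaarMeasure.isInvInvariant_of_regular νK
  haveI : νK.IsMulRightInvariant := isMulRightInvariant_of_isInvInvariant νK
  letI : CommGroup ↥(Subgroup.map (φ : ↥(unitaryGroupOfForm (starRingEnd ℂ) ((Matrix.diagonal ![α (lineOf (formSign L α w₀) 0), α (lineOf (formSign L α w₀) 2)]).map w₀.1.embedding)) →* ↥(unitaryGroupOfForm (starRingEnd ℂ) J)) ((circleDiagonal 2).codRestrict (unitaryGroupOfForm (starRingEnd ℂ) ((Matrix.diagonal ![α (lineOf (formSign L α w₀) 0), α (lineOf (formSign L α w₀) 2)]).map w₀.1.embedding)) (circleDiagonal_mem_archLocal_diagonal L 2 ![α (lineOf (formSign L α w₀) 0), α (lineOf (formSign L α w₀) 2)] w₀)).range) :=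
    { (inferInstance : Group _) with mul_comm := hAcomm }
  let ρA : Measure ↥(Subgroup.map (φ : ↥(unitaryGroupOfForm (starRingEnd ℂ) ((Matrix.diagonal ![α (lineOf (formSign L α w₀) 0), α (lineOf (formSign L α w₀) 2)]).map w₀.1.embedding)) →* ↥(unitaryGroupOfForm (starRingEnd ℂ) J)) ((circleDiagonal 2).codRestrict (unitaryGroupOfForm (starRingEnd ℂ) ((Matrix.diagonal ![α (lineOf (formSign L α w₀) 0), α (lineOf (formSign L α w₀) 2)]).map w₀.1.embedding)) (circleDiagonal_mem_archLocal_diagonal L 2 ![α (lineOf (formSign L α w₀) 0), α (lineOf (formSign L α w₀) 2)] w₀)).range) :=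
    haarMeasure (Classical.arbitrary (TopologicalSpace.PositiveCompacts _))
  haveI : ρA.IsInvInvariant := IsHaarMeasure.isInvInvariant_of_regular ρA
  obtain ⟨κ, hκ, hmap, -⟩ := exists_smul_map_mk_of_block_compact e' ((chartTorusG L α S).subgroupOf _) hTc _ hA hmem Ψ hΨ
    (Measure.map (Subgroup.subgroupOfEquivOfLe hT).symm (chartHaarG L α S)) νM ρA μ₀ νK
  -- ### Harish-Chandra's compactness on a box around `p` (§1) and ONE cut-off `β` (★ p850338)
  obtain ⟨CS, U, hCSc, hUo, hpU, -, -, -, hCM⟩ := exists_isCompact_mul_centralizer_box_of_wall_inRegAt L α S w₀ hα hreal hS hw₀ p x hxp h02c h01 hreg hregS hxin hxS ha's.isCompact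
  obtain ⟨β, hβc, hβs, hβ0, -, hβ1⟩ := exists_continuous_hasCompactSupport_integral_comp_mul_eq_one_pos
    (Subgroup.centralizer ({gprimeTorus L α S p} : Set ↥(arch (↥(maximalRealSubfield L)) L (IsCMField.complexConj L) 3 (Matrix.diagonal α)))) hZc νM (hCSc.insert 1)
  have hβ1S : ∀ x ∈ CS, ∀ k₀ : ↥(Subgroup.centralizer ({gprimeTorus L α S p} : Set ↥(arch (↥(maximalRealSubfield L)) L (IsCMField.complexConj L) 3 (Matrix.diagonal α)))), ∫ h : ↥(Subgroup.centralizer ({gprimeTorus L α S p} : Set ↥(arch (↥(maximalRealSubfield L)) L (IsCMField.complexConj L) 3 (Matrix.diagonal α)))), β (x * (k₀ : ↥(arch (↥(maximalRealSubfield L)) L (IsCMField.complexConj L) 3 (Matrix.diagonal α))) *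
      (h : ↥(arch (↥(maximalRealSubfield L)) L (IsCMField.complexConj L) 3 (Matrix.diagonal α)))) ∂νM = 1 :=
    fun x hx k₀ => hβ1 x (Set.mem_insert_of_mem _ hx) k₀
  -- ### the descended function `(a′)_M^β` (continuous, compactly supported) and its SMOOTH ambient reading (★ aM-SMOOTH, ★ eM-SMOOTH, φ's frame matrix)
  have haMc : Continuous fun m : ↥(Subgroup.centralizer ({gprimeTorus L α S p} : Set ↥(arch (↥(maximalRealSubfield L)) L (IsCMField.complexConj L) 3 (Matrix.diagonal α)))) =>
      ∫ x, β x • a' (x * (m : ↥(arch (↥(maximalRealSubfield L)) L (IsCMField.complexConj L) 3 (Matrix.diagonal α))) * x⁻¹) ∂ν' :=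
    continuous_integral_conj_subtype ν' _ hβc hβs ha'c
  have haMs : HasCompactSupport fun m : ↥(Subgroup.centralizer ({gprimeTorus L α S p} : Set ↥(arch (↥(maximalRealSubfield L)) L (IsCMField.complexConj L) 3 (Matrix.diagonal α)))) =>
      ∫ x, β x • a' (x * (m : ↥(arch (↥(maximalRealSubfield L)) L (IsCMField.complexConj L) 3 (Matrix.diagonal α))) * x⁻¹) ∂ν' :=
    hasCompactSupport_integral_conj ν' _ hZc hβs ha's
  obtain ⟨ΘM, hΘM, haM⟩ := exists_contDiff_descended_eq L 3 (Matrix.diagonal α) ν' ha' β hβc hβs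
    (Subgroup.centralizer ({gprimeTorus L α S p} : Set ↥(arch (↥(maximalRealSubfield L)) L (IsCMField.complexConj L) 3 (Matrix.diagonal α))))
  obtain ⟨Λ, hΛ, hΛb⟩ := exists_contDiff_coe_symm_archPiEquivCM_mulSingle_relabel_endoEmb L α w₀ (lineOf (formSign L α w₀))
  have hΛb' : ∀ b : ↥(unitaryGroupOfForm (starRingEnd ℂ) ((Matrix.diagonal ![α (lineOf (formSign L α w₀) 0), α (lineOf (formSign L α w₀) 2)]).map w₀.1.embedding)),
      ((((e.symm (b, 1) : ↥(Subgroup.centralizer ({gprimeTorus L α S p} : Set ↥(arch (↥(maximalRealSubfield L)) L (IsCMField.complexConj L) 3 (Matrix.diagonal α))))) :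
          ↥(arch (↥(maximalRealSubfield L)) L (IsCMField.complexConj L) 3 (Matrix.diagonal α))) : GL (Fin 3) (mixedSpace L)) : Matrix (Fin 3) (Fin 3) (mixedSpace L)) =
        Λ ((b : GL (Fin 2) ℂ) : Matrix (Fin 2) (Fin 2) ℂ) := fun b => by
    rw [h8 b]; exact hΛb b
  obtain ⟨M₀, hM₀⟩ : ∃ M₀ : GL (Fin 2) ℂ, ∀ h : ↥(unitaryGroupOfForm (starRingEnd ℂ) ((Matrix.diagonal ![α (lineOf (formSign L α w₀) 0), α (lineOf (formSign L α w₀) 2)]).map w₀.1.embedding)),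
      ((φ h : ↥(unitaryGroupOfForm (starRingEnd ℂ) J)) : GL (Fin 2) ℂ) = M₀ * (h : GL (Fin 2) ℂ) * M₀⁻¹ :=
    ⟨_, fun h => by rw [hval h, _root_.mul_inv_rev]⟩
  have hφsymm : ∀ u : ↥(unitaryGroupOfForm (starRingEnd ℂ) J),
      (((φ.symm u : ↥(unitaryGroupOfForm (starRingEnd ℂ) ((Matrix.diagonal ![α (lineOf (formSign L α w₀) 0), α (lineOf (formSign L α w₀) 2)]).map w₀.1.embedding))) : GL (Fin 2) ℂ) : Matrix (Fin 2) (Fin 2) ℂ) =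
        ((M₀⁻¹ : GL (Fin 2) ℂ) : Matrix (Fin 2) (Fin 2) ℂ) * ((u : GL (Fin 2) ℂ) : Matrix (Fin 2) (Fin 2) ℂ) * ((M₀ : GL (Fin 2) ℂ) : Matrix (Fin 2) (Fin 2) ℂ) := fun u => by
    have h := hM₀ (φ.symm u)
    rw [ContinuousMulEquiv.apply_symm_apply] at h
    have h' : ((φ.symm u : ↥(unitaryGroupOfForm (starRingEnd ℂ) ((Matrix.diagonal ![α (lineOf (formSign L α w₀) 0), α (lineOf (formSign L α w₀) 2)]).map w₀.1.embedding))) : GL (Fin 2) ℂ) =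
        M₀⁻¹ * (u : GL (Fin 2) ℂ) * M₀ := by
      rw [h]; group
    rw [h', Units.val_mul, Units.val_mul]
  -- `e′⁻¹(u, r) = e⁻¹(φ⁻¹ u, 1) · r` for every `r ∈ K` (clause [10])
  have hsymm : ∀ (u : ↥(unitaryGroupOfForm (starRingEnd ℂ) J)) (r : ↥K),
      e'.symm (u, r) = e.symm (φ.symm u, 1) * (r : ↥(Subgroup.centralizer ({gprimeTorus L α S p} : Set ↥(arch (↥(maximalRealSubfield L)) L (IsCMField.complexConj L) 3 (Matrix.diagonal α))))) := fun u r => by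
    apply e'.injective
    rw [ContinuousMulEquiv.apply_symm_apply, map_mul, he', he', ContinuousMulEquiv.apply_symm_apply, ContinuousMulEquiv.apply_symm_apply, h10 _ r.2]
    ext <;> simp
  -- ONE ambient cut-off `χ ≡ 1` on the common compact matrix support of all the block test functions
  have hS₀ : IsCompact ((fun u : ↥(unitaryGroupOfForm (starRingEnd ℂ) J) => ((u : GL (Fin 2) ℂ) : Matrix (Fin 2) (Fin 2) ℂ)) '' (Prod.fst '' (e' '' tsupport
      (fun m : ↥(Subgroup.centralizer ({gprimeTorus L α S p} : Set ↥(arch (↥(maximalRealSubfield L)) L (IsCMField.complexConj L) 3 (Matrix.diagonal α)))) =>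
        ∫ x, β x • a' (x * (m : ↥(arch (↥(maximalRealSubfield L)) L (IsCMField.complexConj L) 3 (Matrix.diagonal α))) * x⁻¹) ∂ν')))) :=
    (((haMs.isCompact.image e'.continuous).image continuous_fst).image (Units.continuous_val.comp continuous_subtype_val))
  obtain ⟨χ, hχd, hχc, hχ1, -⟩ := Literature.Analysis.Calculus.exists_contDiff_hasCompactSupport_eq_one_of_isCompact hS₀
  -- the tangential spectator `c ↦ ↑↑γ_{update c w₀ (0, c_{w₀1}, 0)}` is smooth
  have hupd : ContDiff ℝ ∞ fun c : {w : InfinitePlace L // IsComplex w} → Fin 3 → ℝ => Function.update c w₀ (![0, c w₀ 1, 0] : Fin 3 → ℝ) := by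
    refine contDiff_pi.2 fun w => ?_
    rcases eq_or_ne w w₀ with rfl | hw
    · simp only [Function.update_self]
      refine contDiff_pi.2 fun i => ?_
      fin_cases i
      · exact contDiff_const
      · exact contDiff_apply_apply ℝ ℝ w 1
      · exact contDiff_const
    · simp only [Function.update_of_ne hw]
      exact contDiff_apply ℝ (Fin 3 → ℝ) w
  have hRρ : ContDiff ℝ ∞ fun c : {w : InfinitePlace L // IsComplex w} → Fin 3 → ℝ =>
      (((gprimeTorus L α S (Function.update c w₀ (![0, c w₀ 1, 0] : Fin 3 → ℝ)) : ↥(arch (↥(maximalRealSubfield L)) L (IsCMField.complexConj L) 3 (Matrix.diagonal α))) :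
        GL (Fin 3) (mixedSpace L)) : Matrix (Fin 3) (Fin 3) (mixedSpace L)) := (contDiff_coe_gprimeTorus L α S).comp hupd
  -- the family
  obtain ⟨f, hf⟩ : ∃ f : ({w : InfinitePlace L // IsComplex w} → Fin 3 → ℝ) × Matrix (Fin 2) (Fin 2) ℂ → ℂ, f = fun q =>
      (χ q.2 : ℂ) * ΘM (Λ (((M₀⁻¹ : GL (Fin 2) ℂ) : Matrix (Fin 2) (Fin 2) ℂ) * q.2 * ((M₀ : GL (Fin 2) ℂ) : Matrix (Fin 2) (Fin 2) ℂ)) *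
        (((gprimeTorus L α S (Function.update q.1 w₀ (![0, q.1 w₀ 1, 0] : Fin 3 → ℝ)) : ↥(arch (↥(maximalRealSubfield L)) L (IsCMField.complexConj L) 3 (Matrix.diagonal α))) :
          GL (Fin 3) (mixedSpace L)) : Matrix (Fin 3) (Fin 3) (mixedSpace L))) := ⟨_, rfl⟩
  have hfs : ContDiff ℝ ∞ f := by
    rw [hf]
    refine ((Complex.ofRealCLM.contDiff.comp ((hχd ⊤).comp contDiff_snd)).mul
      (hΘM.comp (((hΛ.comp ((contDiff_const.mul contDiff_snd).mul contDiff_const)).mul (hRρ.comp contDiff_fst)))))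
  -- `f (c, ↑↑u) = (a′)_M^β (e′⁻¹(u, (e γ_c).2))` for every `c`, `u`
  have hfB : ∀ (c : {w : InfinitePlace L // IsComplex w} → Fin 3 → ℝ) (u : ↥(unitaryGroupOfForm (starRingEnd ℂ) J)),
      (fun m : ↥(Subgroup.centralizer ({gprimeTorus L α S p} : Set ↥(arch (↥(maximalRealSubfield L)) L (IsCMField.complexConj L) 3 (Matrix.diagonal α)))) =>
        ∫ x, β x • a' (x * (m : ↥(arch (↥(maximalRealSubfield L)) L (IsCMField.complexConj L) 3 (Matrix.diagonal α))) * x⁻¹) ∂ν')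
        (e'.symm (u, (e ⟨gprimeTorus L α S c, gprimeTorus_mem_centralizer L α S p c⟩).2)) = f (c, ((u : GL (Fin 2) ℂ) : Matrix (Fin 2) (Fin 2) ℂ)) := by
    intro c u
    have haM' := congrFun haM (e'.symm (u, (e ⟨gprimeTorus L α S c, gprimeTorus_mem_centralizer L α S p c⟩).2))
    beta_reduce at haM'
    beta_reduce
    -- the smooth reading of the value
    have hread : ΘM ((((e'.symm (u, (e ⟨gprimeTorus L α S c, gprimeTorus_mem_centralizer L α S p c⟩).2) :
        ↥(Subgroup.centralizer ({gprimeTorus L α S p} : Set ↥(arch (↥(maximalRealSubfield L)) L (IsCMField.complexConj L) 3 (Matrix.diagonal α))))) :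
          ↥(arch (↥(maximalRealSubfield L)) L (IsCMField.complexConj L) 3 (Matrix.diagonal α))) : GL (Fin 3) (mixedSpace L)) : Matrix (Fin 3) (Fin 3) (mixedSpace L)) =
        ΘM (Λ (((M₀⁻¹ : GL (Fin 2) ℂ) : Matrix (Fin 2) (Fin 2) ℂ) * ((u : GL (Fin 2) ℂ) : Matrix (Fin 2) (Fin 2) ℂ) * ((M₀ : GL (Fin 2) ℂ) : Matrix (Fin 2) (Fin 2) ℂ)) *
          (((gprimeTorus L α S (Function.update c w₀ (![0, c w₀ 1, 0] : Fin 3 → ℝ)) : ↥(arch (↥(maximalRealSubfield L)) L (IsCMField.complexConj L) 3 (Matrix.diagonal α))) :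
            GL (Fin 3) (mixedSpace L)) : Matrix (Fin 3) (Fin 3) (mixedSpace L))) := by
      rw [hsymm, Subgroup.coe_mul, Subgroup.coe_mul, Units.val_mul, hΛb' (φ.symm u), hφsymm u, h6 c]
    by_cases hu : (e'.symm (u, (e ⟨gprimeTorus L α S c, gprimeTorus_mem_centralizer L α S p c⟩).2)) ∈ tsupport
        (fun m : ↥(Subgroup.centralizer ({gprimeTorus L α S p} : Set ↥(arch (↥(maximalRealSubfield L)) L (IsCMField.complexConj L) 3 (Matrix.diagonal α)))) =>
          ∫ x, β x • a' (x * (m : ↥(arch (↥(maximalRealSubfield L)) L (IsCMField.complexConj L) 3 (Matrix.diagonal α))) * x⁻¹) ∂ν')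
    · have hχu : χ ((u : GL (Fin 2) ℂ) : Matrix (Fin 2) (Fin 2) ℂ) = 1 :=
        hχ1 _ ⟨u, ⟨(u, (e ⟨gprimeTorus L α S c, gprimeTorus_mem_centralizer L α S p c⟩).2), ⟨_, hu, e'.apply_symm_apply _⟩, rfl⟩, rfl⟩
      rw [hf]
      beta_reduce
      rw [hχu, Complex.ofReal_one, one_mul, haM', hread]
    · have h0 := image_eq_zero_of_notMem_tsupport hu
      beta_reduce at h0
      have h0' := h0
      rw [haM', hread] at h0'
      rw [h0, hf]
      beta_reduce
      rw [h0', mul_zero]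
  -- ### the descent constant `K = dt′(B′)·κ ≠ 0`
  have hdtS := toReal_chartHaarG_chartBoxImgG_pos L α S hα hS
  have hK0 : (((chartHaarG L α S (chartBoxImgG L α S)).toReal : ℂ) * ((κ : ℝ) : ℂ)) ≠ 0 :=
    mul_ne_zero (Complex.ofReal_ne_zero.2 hdtS.ne') (Complex.ofReal_ne_zero.2 (NNReal.coe_ne_zero.2 hκ))
  -- ### integrability at regular chart points (★ p850485)
  letI : MeasurableSpace (↥(arch (↥(maximalRealSubfield L)) L (IsCMField.complexConj L) 3 (Matrix.diagonal α)) ⧸ chartTorusG L α S) := borel _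
  haveI : BorelSpace (↥(arch (↥(maximalRealSubfield L)) L (IsCMField.complexConj L) 3 (Matrix.diagonal α)) ⧸ chartTorusG L α S) := ⟨rfl⟩
  haveI := isMulLeftInvariant_chartHaarG L α S
  haveI := isFiniteMeasureOnCompacts_chartHaarG L α S
  haveI := isOpenPosMeasure_chartHaarG L α S
  have hq : chartQuotientMeasureG L α ν' S = quotientMeasure (chartTorusG L α S) (chartHaarG L α S) (isClosed_chartTorusG L α S) ν' := rfl
  haveI : IsFiniteMeasureOnCompacts (chartQuotientMeasureG L α ν' S) := by rw [hq]; infer_instance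
  -- ### the block reading of `γ_c` through `e′` ([5] + (B-STD) (i))
  have hγ : ∀ c : {w : InfinitePlace L // IsComplex w} → Fin 3 → ℝ,
      e' ⟨gprimeTorus L α S c, hT (gprimeTorus_mem_chartTorusG L α S c)⟩ =
        ((⟨Matrix.GeneralLinearGroup.mkOfDetNeZero !![(1 : ℂ), 1; 1, -1] det_cayleyTwo_ne_zero *
            circleDiagonal 2 ![Circle.exp (c w₀ 0), Circle.exp (c w₀ 2)] *
            (Matrix.GeneralLinearGroup.mkOfDetNeZero !![(1 : ℂ), 1; 1, -1] det_cayleyTwo_ne_zero)⁻¹, cayley_conj_circleDiagonal_mem_of_eq_over hJ _⟩ : ↥(unitaryGroupOfForm (starRingEnd ℂ) J)),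
          (e ⟨gprimeTorus L α S c, gprimeTorus_mem_centralizer L α S p c⟩).2) := by
    intro c
    have h1 : (e ⟨gprimeTorus L α S c, gprimeTorus_mem_centralizer L α S p c⟩).1 =
        ⟨circleDiagonal 2 ![Circle.exp (c w₀ 0), Circle.exp (c w₀ 2)],
          circleDiagonal_mem_unitaryGroupOfForm_diagonal_map_weights w₀.1.embedding ![α (lineOf (formSign L α w₀) 0), α (lineOf (formSign L α w₀) 2)] _⟩ :=
      Subtype.ext (h5 c)
    rw [he', h1, hφ]
  -- ### assembling
  refine ⟨(((chartHaarG L α S (chartBoxImgG L α S)).toReal : ℂ) * ((κ : ℝ) : ℂ)), U, f, hK0, hUo, hpU, hfs, ⟨tsupport χ, hχc, fun c X hX => ?_⟩, fun c X => ?_, ?_⟩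
  · rw [hf]; dsimp only; rw [image_eq_zero_of_notMem_tsupport hX, Complex.ofReal_zero, zero_mul]
  · rw [hf]; dsimp only; rw [Function.update_idem, Function.update_self]
    simp
  rintro c ⟨hcU, hcreg⟩
  have hint := integrable_descConj_gprimeTorus_of_regG L α S hα hS hcreg ha'c ha's (chartQuotientMeasureG L α ν' S)
  rw [chartOrbG_eq_integral_descended_of_cutoff L α ν' S a' ha'c (gprimeTorus L α S p) νM hT hβc hβs hβ0 hβ1S c hint (hCM c hcU),
    integral_descConj_eq_smul_integral_of_block _ _ e' Ψ hΨ _ μ₀ hmap _ _ _ (hγ c) _ haMc, NNReal.smul_def, Complex.real_smul, ← mul_assoc]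
  congr 1
  refine integral_congr_ae (Filter.Eventually.of_forall fun b => ?_)
  exact hfB c _

end Chart


/-! ## §3 (H-core) in the `orbFamG` currency of ★ p851168's `hpack` binder: `orbFamG c = Φ₀(c) · (K · ∫ f)` with the other normalising factors absorbed into `f` -/

section Core

variable (L : Type) [Field L] [NumberField L] [IsCMField L] (α : Fin 3 → L)
  [MeasurableSpace ↥(arch (↥(maximalRealSubfield L)) L (IsCMField.complexConj L) 3 (Matrix.diagonal α))]
  [BorelSpace ↥(arch (↥(maximalRealSubfield L)) L (IsCMField.complexConj L) 3 (Matrix.diagonal α))]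
  (ν' : Measure ↥(arch (↥(maximalRealSubfield L)) L (IsCMField.complexConj L) 3 (Matrix.diagonal α))) [ν'.IsHaarMeasure] [ν'.IsMulRightInvariant]

/-- **(B-desc′) (H-core) OFF THE REAL WALLS — ★ p851168's `hpack` binder.**  Base point `x`: the noncompact coincidence `e^{ix_{w₀0}} = e^{ix_{w₀2}} ≠ e^{ix_{w₀1}}` at the covered compact
place `w₀ ∉ S`, IN-REGULAR at the other compact places, OFF the real walls on `S` (`x_w 0 ≠ 0`); `a′ ∈ C_c^∞(G′_∞)`, any Haar `μ₀` on `U(J)`.  THEN there are `K ≠ 0`, an open `U ∋ x` and a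
JOINTLY SMOOTH `f`, compactly supported in the matrix variable uniformly in `c`, depending on `c_{w₀}` only through `c_{w₀1}`, with `U ∩ {e^{ic_{w₀0}} ≠ e^{ic_{w₀2}}} ⊆ InRegG (slotSign α) S`
and, for every `G`-REGULAR `c ∈ U`,
**`orbFamG L α ν′ a′ S c = (1−e^{i(c₁−c₀)})(1−e^{i(c₂−c₀)})(1−e^{i(c₂−c₁)})_{w₀} · (K · ∫_{U(J)} f(c, ↑↑(h · P diag(e^{ic_{w₀0}}, e^{ic_{w₀2}}) P⁻¹ · h⁻¹)) dμ₀)`** — §2 at the auxiliary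
semiregular `p` (`= x` at `w₀`, a regular reference elsewhere), Shelstad's normaliser split (★ `archRG_eq_prod_cpt_mul_prod_split`, ★ `orbFamG_apply`) with every factor other than the
three `w₀`-factors absorbed into `f` (the other compact factors are entire, ★ `contDiff_prod_cptFactor`-style; the split factors are cut off smoothly near `x_w 0 ≠ 0`,
`contDiff_bump_mul_splitFactor`). [cite: Rogawski1990, §4.12 Lemma 4.12.1 p. 61; §8.2 pp. 118–124] [cite: Shelstad1979, §4 pp. 22–25] [cite: Varadarajan1977, I §1.12] -/
theorem exists_descent_box_orbFamG_corePackage_of_wall_inRegAt (hα : ∀ i, α i ≠ 0)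
    (hreal : ∀ (w : {w : InfinitePlace L // IsComplex w}) (i : Fin 3), (w.1.embedding (α i)).im = 0)
    {J : Matrix (Fin 2) (Fin 2) ℂ} (hJ : J = (StdForm.antidiagonal 2).over ℂ)
    [MeasurableSpace ↥(unitaryGroupOfForm (starRingEnd ℂ) J)] [BorelSpace ↥(unitaryGroupOfForm (starRingEnd ℂ) J)]
    [LocallyCompactSpace ↥(unitaryGroupOfForm (starRingEnd ℂ) J)] [SecondCountableTopology ↥(unitaryGroupOfForm (starRingEnd ℂ) J)]
    (μ₀ : Measure ↥(unitaryGroupOfForm (starRingEnd ℂ) J)) [μ₀.IsHaarMeasure] [μ₀.IsMulRightInvariant]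
    {S : Finset {w : InfinitePlace L // IsComplex w}} {w₀ : {w : InfinitePlace L // IsComplex w}} {x : {w : InfinitePlace L // IsComplex w} → Fin 3 → ℝ}
    (hS : ∀ w, w ∈ S → w ∈ splitChartPlaces L α) (hw₀ : w₀ ∉ S) (hwsp : w₀ ∈ splitChartPlaces L α)
    (hx02 : Circle.exp (x w₀ 0) = Circle.exp (x w₀ 2)) (hx1 : Circle.exp (x w₀ 1) ≠ Circle.exp (x w₀ 0))
    (hxin : ∀ w, w ∉ S → w ≠ w₀ → ∀ i j : Fin 3, i ≠ j → slotSign L α w i ≠ slotSign L α w j → Circle.exp (x w i) ≠ Circle.exp (x w j))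
    (hxS : ∀ w, w ∈ S → x w 0 ≠ 0)
    {a' : ↥(arch (↥(maximalRealSubfield L)) L (IsCMField.complexConj L) 3 (Matrix.diagonal α)) → ℂ} (ha' : ArchSmooth L 3 (Matrix.diagonal α) a') :
    ∃ (K : ℂ) (U : Set ({w : InfinitePlace L // IsComplex w} → Fin 3 → ℝ)) (f : ({w : InfinitePlace L // IsComplex w} → Fin 3 → ℝ) × Matrix (Fin 2) (Fin 2) ℂ → ℂ),
      K ≠ 0 ∧ IsOpen U ∧ x ∈ U ∧ ContDiff ℝ ∞ f ∧
      (∃ C : Set (Matrix (Fin 2) (Fin 2) ℂ), IsCompact C ∧ ∀ c X, X ∉ C → f (c, X) = 0) ∧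
      (∀ c X, f (c, X) = f (Function.update c w₀ ![0, c w₀ 1, 0], X)) ∧
      (∀ c ∈ U, Circle.exp (c w₀ 0) ≠ Circle.exp (c w₀ 2) → c ∈ InRegG (slotSign L α) S) ∧
      ∀ c ∈ U, c ∈ RegG S →
        orbFamG L α ν' a' S c =
          (1 - (Circle.exp (c w₀ 1 - c w₀ 0) : ℂ)) * (1 - (Circle.exp (c w₀ 2 - c w₀ 0) : ℂ)) * (1 - (Circle.exp (c w₀ 2 - c w₀ 1) : ℂ)) *
          (K * ∫ h : ↥(unitaryGroupOfForm (starRingEnd ℂ) J),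
            f (c, (((h * ⟨Matrix.GeneralLinearGroup.mkOfDetNeZero !![(1 : ℂ), 1; 1, -1] det_cayleyTwo_ne_zero *
                  circleDiagonal 2 ![Circle.exp (c w₀ 0), Circle.exp (c w₀ 2)] *
                  (Matrix.GeneralLinearGroup.mkOfDetNeZero !![(1 : ℂ), 1; 1, -1] det_cayleyTwo_ne_zero)⁻¹,
                cayley_conj_circleDiagonal_mem_of_eq_over hJ _⟩ * h⁻¹ : ↥(unitaryGroupOfForm (starRingEnd ℂ) J)) : GL (Fin 2) ℂ) : Matrix (Fin 2) (Fin 2) ℂ)) ∂μ₀) := by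
  -- ### the auxiliary semiregular point `p`: `x` at `w₀`, a regular reference elsewhere
  obtain ⟨c₀, hc₀⟩ := (dense_regG S).nonempty
  obtain ⟨p, hpdef⟩ : ∃ p : {w : InfinitePlace L // IsComplex w} → Fin 3 → ℝ, p = Function.update c₀ w₀ (x w₀) := ⟨_, rfl⟩
  have hpw₀ : p w₀ = x w₀ := by rw [hpdef, Function.update_self]
  have hpw : ∀ w, w ≠ w₀ → p w = c₀ w := fun w hw => by rw [hpdef, Function.update_of_ne hw]
  have hxp : x w₀ = p w₀ := hpw₀.symm
  have h02c : Circle.exp (p w₀ 0) = Circle.exp (p w₀ 2) := by rw [hpw₀]; exact hx02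
  have h01 : Circle.exp (p w₀ 0) ≠ Circle.exp (p w₀ 1) := by rw [hpw₀]; exact fun h => hx1 h.symm
  have hreg : ∀ w, w ≠ w₀ → w ∉ S → Function.Injective fun i : Fin 3 => Circle.exp (p w i) := fun w hw hwS => by
    rw [hpw w hw]; exact ((mem_regG_iff S c₀).1 hc₀).1 w hwS
  have hregS : ∀ w, w ∈ S → p w 0 ≠ 0 := fun w hwS => by
    rw [hpw w (fun h => hw₀ (h ▸ hwS))]; exact ((mem_regG_iff S c₀).1 hc₀).2 w hwS
  -- ### §2 at `p`
  obtain ⟨K, U, f, hK, hUo, hxU, hf, hfC, hft, hid⟩ :=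
    exists_descent_box_chartOrbG_of_wall_inRegAt L α ν' hα hreal hJ μ₀ hS hw₀ hwsp hxp h02c h01 hreg hregS hxin hxS ha'
  -- ### the box `V ∋ x` (slot `1` simple at `w₀`, in-regular at the other compact places, off the real walls) — for clause 7
  obtain ⟨V, hVdef⟩ : ∃ V : Set ({w : InfinitePlace L // IsComplex w} → Fin 3 → ℝ), V =
      {c | (∀ j : Fin 3, j ≠ 1 → Circle.exp (c w₀ 1) ≠ Circle.exp (c w₀ j)) ∧
        (∀ w, w ∉ S → w ≠ w₀ → ∀ i j : Fin 3, i ≠ j → slotSign L α w i ≠ slotSign L α w j → Circle.exp (c w i) ≠ Circle.exp (c w j)) ∧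
        (∀ w, w ∈ S → c w 0 ≠ 0)} := ⟨_, rfl⟩
  have hVo : IsOpen V := by rw [hVdef]; exact isOpen_setOf_wallBox L α S w₀
  have hxV : x ∈ V := by
    rw [hVdef]
    refine ⟨fun j hj => ?_, hxin, hxS⟩
    fin_cases j
    · exact hx1
    · exact absurd rfl hj
    · exact fun h => hx1 (h.trans hx02.symm)
  -- ### the cut-off of the split factors near `x_w 0 ≠ 0`
  have hβ : ∀ w : ↥S, ∃ β : ContDiffBump (x w.1 0), β.rOut < |x w.1 0| := fun w =>
    ⟨⟨|x w.1 0| / 4, |x w.1 0| / 2, by have := abs_pos.2 (hxS w.1 w.2); positivity, by have := abs_pos.2 (hxS w.1 w.2); linarith⟩,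
      by show |x w.1 0| / 2 < |x w.1 0|; have := abs_pos.2 (hxS w.1 w.2); linarith⟩
  choose β hβ using hβ
  obtain ⟨W, hWdef⟩ : ∃ W : Set ({w : InfinitePlace L // IsComplex w} → Fin 3 → ℝ), W = {c | ∀ w : ↥S, c w.1 0 ∈ Metric.ball (x w.1 0) (β w).rIn} := ⟨_, rfl⟩
  have hWo : IsOpen W := by
    have h : W = ⋂ w : ↥S, {c : {w : InfinitePlace L // IsComplex w} → Fin 3 → ℝ | c w.1 0 ∈ Metric.ball (x w.1 0) (β w).rIn} := by
      rw [hWdef]; ext c; simp only [mem_setOf_eq, mem_iInter]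
    rw [h]
    exact isOpen_iInter_of_finite fun w => Metric.isOpen_ball.preimage ((continuous_apply 0).comp (continuous_apply w.1))
  have hxW : x ∈ W := by
    rw [hWdef]
    exact fun w => Metric.mem_ball_self (β w).rIn_pos
  -- ### the factors absorbed into `f`: the other compact factors (entire) and the cut-off split factors
  obtain ⟨R, hRdef⟩ : ∃ R : ({w : InfinitePlace L // IsComplex w} → Fin 3 → ℝ) → ℂ, R = fun c =>
      (∏ w ∈ (Finset.univ.filter (fun w => w ∉ S)).erase w₀,
          (1 - (Circle.exp (c w 1 - c w 0) : ℂ)) * (1 - (Circle.exp (c w 2 - c w 0) : ℂ)) * (1 - (Circle.exp (c w 2 - c w 1) : ℂ))) *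
        ∏ w : ↥S, (((β w (c w 0) * (|Real.exp (c w 0) - Real.exp (-c w 0)| *
          ‖Complex.exp (c w 0 + c w 2 * I) - Complex.exp (c w 1 * I)‖ * ‖Complex.exp (-c w 0 + c w 2 * I) - Complex.exp (c w 1 * I)‖) : ℝ) : ℂ)) := ⟨_, rfl⟩
  have hRs : ContDiff ℝ ∞ R := by
    rw [hRdef]
    refine (contDiff_prod fun w _ => ?_).mul (contDiff_prod fun w _ => contDiff_bump_mul_splitFactor w.1 (β w) (hβ w))
    have he : ∀ i j : Fin 3, ContDiff ℝ ∞ fun c : {w : InfinitePlace L // IsComplex w} → Fin 3 → ℝ => (Circle.exp (c w j - c w i) : ℂ) := by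
      intro i j
      have h : (fun c : {w : InfinitePlace L // IsComplex w} → Fin 3 → ℝ => (Circle.exp (c w j - c w i) : ℂ)) =
          fun c => Complex.exp (((c w j - c w i : ℝ) : ℂ) * I) := funext fun c => Circle.coe_exp _
      rw [h]
      exact Complex.contDiff_exp.comp ((ofRealCLM.contDiff.comp ((contDiff_apply_apply ℝ ℝ w j).sub (contDiff_apply_apply ℝ ℝ w i))).mul contDiff_const)
    exact ((contDiff_const.sub (he 0 1)).mul (contDiff_const.sub (he 0 2))).mul (contDiff_const.sub (he 1 2))
  -- tangential invariance of `R` (no `w₀`-coordinate enters)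
  have hRt : ∀ c : {w : InfinitePlace L // IsComplex w} → Fin 3 → ℝ, R c = R (Function.update c w₀ ![0, c w₀ 1, 0]) := by
    intro c
    rw [hRdef]
    dsimp only
    congr 1
    · refine Finset.prod_congr rfl fun w hw => ?_
      rw [Function.update_of_ne (Finset.ne_of_mem_erase hw)]
    · refine Finset.prod_congr rfl fun w _ => ?_
      rw [Function.update_of_ne (ne_of_mem_of_not_mem w.2 hw₀)]
  -- on `W` the cut-offs are `1`, so `R c` IS the product of the absorbed factors of `archRG`
  have hRW : ∀ c ∈ W, archRG S c =
      (1 - (Circle.exp (c w₀ 1 - c w₀ 0) : ℂ)) * (1 - (Circle.exp (c w₀ 2 - c w₀ 0) : ℂ)) * (1 - (Circle.exp (c w₀ 2 - c w₀ 1) : ℂ)) * R c := by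
    intro c hc
    rw [hWdef] at hc
    rw [archRG_eq_prod_cpt_mul_prod_split S c, hRdef]
    dsimp only
    have hw₀mem : w₀ ∈ Finset.univ.filter (fun w : {w : InfinitePlace L // IsComplex w} => w ∉ S) := Finset.mem_filter.2 ⟨Finset.mem_univ _, hw₀⟩
    rw [← Finset.mul_prod_erase _ _ hw₀mem, mul_assoc]
    congr 2
    refine Finset.prod_congr rfl fun w _ => ?_
    rw [(β w).one_of_mem_closedBall (Metric.ball_subset_closedBall (hc w)), one_mul]
  -- ### clause 7: the box meets `InRegG` off the `w₀`-wall
  have hU7 : ∀ c ∈ U ∩ V ∩ W, Circle.exp (c w₀ 0) ≠ Circle.exp (c w₀ 2) → c ∈ InRegG (slotSign L α) S := by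
    rintro c ⟨⟨-, hcV⟩, -⟩ hc02
    rw [hVdef] at hcV
    intro w hw i j hij hs
    by_cases hww : w = w₀
    · subst hww
      have h1 := hcV.1
      fin_cases i <;> fin_cases j
      · exact absurd rfl hij
      · exact fun h => h1 0 (by decide) h.symm
      · exact hc02
      · exact h1 0 (by decide)
      · exact absurd rfl hij
      · exact h1 2 (by decide)
      · exact fun h => hc02 h.symm
      · exact fun h => h1 2 (by decide) h.symm
      · exact absurd rfl hij
    · exact hcV.2.1 w hw hww i j hij hs
  -- ### assembling
  obtain ⟨C, hCc, hfC'⟩ := hfC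
  refine ⟨K, U ∩ V ∩ W, fun q => R q.1 * f q, hK, (hUo.inter hVo).inter hWo, ⟨⟨hxU, hxV⟩, hxW⟩, (hRs.comp contDiff_fst).mul hf,
    ⟨C, hCc, fun c X hX => by dsimp only; rw [hfC' c X hX, mul_zero]⟩, fun c X => ?_, hU7, ?_⟩
  · dsimp only
    rw [← hRt c, ← hft c X]
  rintro c ⟨⟨hcU, hcV⟩, hcW⟩ hcreg
  rw [orbFamG_apply L α ν' a' hS c, hRW c hcW, hid c ⟨hcU, hcreg⟩]
  dsimp only
  rw [integral_const_mul]
  ring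

end Core


/-! ## §4 (ED. 2) The (B-desc′) head off the real walls: §3 through ★ p851168's assembly -/

section Head

variable (L : Type) [Field L] [NumberField L] [IsCMField L] (α : Fin 3 → L)
  [MeasurableSpace ↥(arch (↥(maximalRealSubfield L)) L (IsCMField.complexConj L) 3 (Matrix.diagonal α))]
  [BorelSpace ↥(arch (↥(maximalRealSubfield L)) L (IsCMField.complexConj L) 3 (Matrix.diagonal α))]
  (ν' : Measure ↥(arch (↥(maximalRealSubfield L)) L (IsCMField.complexConj L) 3 (Matrix.diagonal α))) [ν'.IsHaarMeasure] [ν'.IsMulRightInvariant]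

/-- **(B-desc′) HEAD OFF THE REAL WALLS — box descent of the EXTENDED genuine family `orbFamGExt` at a one-wall point whose other compact places are only in-regular.**  Base point `x`:
`e^{ix_{w₀0}} = e^{ix_{w₀2}} ≠ e^{ix_{w₀1}}` at the covered compact place `w₀ ∉ S`, in-regular at the other compact places, `x_w 0 ≠ 0` on `S`; then `K ≠ 0`, an open `U ∋ x`, a jointly
smooth, uniformly matrix-compactly-supported, tangential `f` with `U ∩ {off the w₀-wall} ⊆ InRegG` and
**`orbFamGExt L α ν′ a′ S c = Φ₀(c) · (K · ∫_{U(J)} f(c, ↑↑(h · P diag(e^{ic_{w₀0}}, e^{ic_{w₀2}}) P⁻¹ · h⁻¹)) dμ₀)` for EVERY `c ∈ U` off the `w₀`-wall** (compact walls of the other places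
included) — §3 (`hpack`) through ★ p851168 `exists_descent_box_orbFamGExt_inRegG_of_corePackage` ((H-cont) + the dock ★ `hcExtendG_eqOn_of_continuousOn`).
[cite: Rogawski1990, §4.12 Lemma 4.12.1 p. 61; §8.2 pp. 119–124] [cite: Varadarajan1977, I §1.12] [cite: Bouaziz1994IntegralesOrbitales, §6.2 p. 591] [cite: Shelstad1979, §4 Lemma 4.3 (p. 25)] -/
theorem exists_descent_box_orbFamGExt_inRegG_of_wall_inRegAt (hα : ∀ i, α i ≠ 0)
    (hreal : ∀ (w : {w : InfinitePlace L // IsComplex w}) (i : Fin 3), (w.1.embedding (α i)).im = 0)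
    {J : Matrix (Fin 2) (Fin 2) ℂ} (hJ : J = (StdForm.antidiagonal 2).over ℂ)
    [MeasurableSpace ↥(unitaryGroupOfForm (starRingEnd ℂ) J)] [BorelSpace ↥(unitaryGroupOfForm (starRingEnd ℂ) J)]
    [LocallyCompactSpace ↥(unitaryGroupOfForm (starRingEnd ℂ) J)] [SecondCountableTopology ↥(unitaryGroupOfForm (starRingEnd ℂ) J)]
    (μ₀ : Measure ↥(unitaryGroupOfForm (starRingEnd ℂ) J)) [μ₀.IsHaarMeasure] [μ₀.IsMulRightInvariant]
    {S : Finset {w : InfinitePlace L // IsComplex w}} {w₀ : {w : InfinitePlace L // IsComplex w}} {x : {w : InfinitePlace L // IsComplex w} → Fin 3 → ℝ}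
    (hS : ∀ w, w ∈ S → w ∈ splitChartPlaces L α) (hw₀ : w₀ ∉ S) (hwsp : w₀ ∈ splitChartPlaces L α)
    (hx02 : Circle.exp (x w₀ 0) = Circle.exp (x w₀ 2)) (hx1 : Circle.exp (x w₀ 1) ≠ Circle.exp (x w₀ 0))
    (hxin : ∀ w, w ∉ S → w ≠ w₀ → ∀ i j : Fin 3, i ≠ j → slotSign L α w i ≠ slotSign L α w j → Circle.exp (x w i) ≠ Circle.exp (x w j))
    (hxS : ∀ w, w ∈ S → x w 0 ≠ 0)
    {a' : ↥(arch (↥(maximalRealSubfield L)) L (IsCMField.complexConj L) 3 (Matrix.diagonal α)) → ℂ} (ha' : ArchSmooth L 3 (Matrix.diagonal α) a') :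
    ∃ (K : ℂ) (U : Set ({w : InfinitePlace L // IsComplex w} → Fin 3 → ℝ)) (f : ({w : InfinitePlace L // IsComplex w} → Fin 3 → ℝ) × Matrix (Fin 2) (Fin 2) ℂ → ℂ),
      K ≠ 0 ∧ IsOpen U ∧ x ∈ U ∧ ContDiff ℝ ∞ f ∧
      (∃ C : Set (Matrix (Fin 2) (Fin 2) ℂ), IsCompact C ∧ ∀ c X, X ∉ C → f (c, X) = 0) ∧
      (∀ c X, f (c, X) = f (Function.update c w₀ ![0, c w₀ 1, 0], X)) ∧
      (∀ c ∈ U, Circle.exp (c w₀ 0) ≠ Circle.exp (c w₀ 2) → c ∈ InRegG (slotSign L α) S) ∧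
      ∀ c ∈ U, Circle.exp (c w₀ 0) ≠ Circle.exp (c w₀ 2) →
        orbFamGExt L α ν' a' S c =
          (1 - (Circle.exp (c w₀ 1 - c w₀ 0) : ℂ)) * (1 - (Circle.exp (c w₀ 2 - c w₀ 0) : ℂ)) * (1 - (Circle.exp (c w₀ 2 - c w₀ 1) : ℂ)) *
          (K * ∫ h : ↥(unitaryGroupOfForm (starRingEnd ℂ) J),
            f (c, (((h * ⟨Matrix.GeneralLinearGroup.mkOfDetNeZero !![(1 : ℂ), 1; 1, -1] det_cayleyTwo_ne_zero *
                  circleDiagonal 2 ![Circle.exp (c w₀ 0), Circle.exp (c w₀ 2)] *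
                  (Matrix.GeneralLinearGroup.mkOfDetNeZero !![(1 : ℂ), 1; 1, -1] det_cayleyTwo_ne_zero)⁻¹,
                cayley_conj_circleDiagonal_mem_of_eq_over hJ _⟩ * h⁻¹ : ↥(unitaryGroupOfForm (starRingEnd ℂ) J)) : GL (Fin 2) ℂ) : Matrix (Fin 2) (Fin 2) ℂ)) ∂μ₀) :=
  exists_descent_box_orbFamGExt_inRegG_of_corePackage L α ν' hJ μ₀
    (exists_descent_box_orbFamG_corePackage_of_wall_inRegAt L α ν' hα hreal hJ μ₀ hS hw₀ hwsp hx02 hx1 hxin hxS ha')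

end Head

end Literature.NumberTheory.Rogawski1990

end
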